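import Literature.NumberTheory.Automorphic.SplitOrthogonalSatakeOrbitSumBasis
import HarnessLib

/-!
# Unitriangularity of the Cartan operators in the orbit-sum basis: `𝒮_1(T_c) = S_c + ∑_{λ > c} n_c(λ) S_λ` for
# `U(σ, J₀)` and for `O_N(J₀)`, over every commutative ring `R` (Henniart–Vignéras §7.14; Gross (3.9)–(3.11))

Topic `NumberTheory/Automorphic`; namespace `Literature.NumberTheory.Automorphic.HermitianLattice.UnramifiedLocalConjDatum`
(lane `lit-hodgefound`, Track 2 foundations; seat `lit-hodgefound-p11`, generation 49, row g49-#13).  THEOREMS ONLY: no definition,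
no named fact, no instance, no notation.  A rider to g49-#8 (`HyperspecialUnitarySatakeOrbitSumBasis`) and g49-#10
(`SplitOrthogonalSatakeOrbitSumBasis`).

## The print and the mathematics

[HenniartVigneras2013] §7.14: «For `λ ∈ Λ⁻` write `E_λ` for the characteristic function of `KzK` when `z` has image `λ`. […] by 6.10
Proposition, we have `S_ℤ(E_λ) = S_λ + Φ_λ` where `Φ_λ` is a `ℤ`-linear combination of `S_μ` with `μ` in `Λ⁻(r)`»;
[GrossSatake1998] (3.9)–(3.11): «`S(c_λ) = q^{⟨λ,ρ⟩} χ_λ + ∑_{μ<λ} a_λ(μ) χ_μ` […] If one takes the scaled basis `φ_λ = q^{⟨λ,ρ⟩} χ_λ` […]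
one finds that `S(c_λ) = φ_λ + ∑_{μ<λ} b_λ(μ) φ_μ` with coefficients `b_λ(μ)` in `ℤ`».

HERE, for the Cartan operator `T_c = 𝟙_{K₀ ϖ^c K₀}` of an antidominant antisymmetric `c` (`c` monotone, `c ∘ rev = -c`) in
`ℋ(U(σ,J₀), K₀; R)` (`σ ≠ id`) resp. `ℋ(O_N(J₀), K₀; R)` (`σ = id`), over EVERY commutative ring `R`:
`𝒮_1(T_c) = S_c + ∑_{λ} n_c(λ) S_λ`, the sum over the antidominant `λ ≠ c` in the support of `𝒮_1(T_c)` — all of which lie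
dominance-ABOVE `c` (`∑_{i<r} c_i ≤ ∑_{i<r} λ_i` for all `r`, Bruhat–Tits (4.4.4) (i)) — with the natural-number coefficients
`n_c(λ) = #{γ ⊆ K₀ϖ^cK₀ : a(γ) = λ}` (cast to `R`); the coefficient of `S_c` is `1` because exactly one coset of `K₀ϖ^cK₀` has
exponents `c` (Bruhat–Tits (4.4.4) (ii)).  Proof: expand `𝒮_1(T_c) ∈ 𝒯_R` in the orbit-sum basis (g49-#8/#10
`eq_sum_coeff_smul_…OrbitSum_of_mem`) and split off the term at `c`.  When `q = 0` in `R` the orbit sums are monomials and the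
expansion reads `𝒮_1(T_c) = x^c + ∑_λ n_c(λ) x^λ`.

## What is formalised (theorems only)

* `U(σ,J₀)`: **`satakeTransform_one_doubleCosetOperator_eq_twistedOrbitSum_add`**, `ne_and_headSum_le_of_mem_erase_support`
  (the index set consists of antidominant `λ ≠ c` dominance-above `c`), `satakeTransform_one_doubleCosetOperator_eq_single_add_of_cast_eq_zero`.
* `O_N(J₀)`: **`satakeTransform_one_doubleCosetOperator_eq_orthogonalTwistedOrbitSum_add`**,
  `ne_and_headSum_le_of_mem_erase_support_orthogonal`.

## References
* [HenniartVigneras2013] G. Henniart, M.-F. Vignéras, *A Satake isomorphism for representations modulo p of reductive groups over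
  local fields*, J. reine angew. Math. 701 (2015), §6.10, §7.14.
* [GrossSatake1998] B. H. Gross, *On the Satake isomorphism* (1998), (3.9)–(3.11).
* [BruhatTits1972] F. Bruhat, J. Tits, *Groupes réductifs sur un corps local I*, Publ. Math. IHÉS 41 (1972), Prop. (4.4.4).
-/

noncomputable section

open scoped Valued WithZero Matrix MatrixGroups
open MonoidAlgebra Representation

namespace Literature.NumberTheory.Automorphic.HermitianLattice

open Literature.NumberTheory.Automorphic Literature.NumberTheory.Automorphic.CartanUnique
  Literature.NumberTheory.Automorphic.SymplecticCartan

variable {R : Type*} [CommRing R] {N : ℕ}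

variable {K : Type*} [Field K] [Valued K ℤᵐ⁰] {σ : K →+* K} {ϖ : K}

namespace UnramifiedLocalConjDatum

/-! ## §1 `U(σ, J₀)` -/

section Unitary

variable [Finite 𝓀[K]]
  [IsHeckeTriple (⊤ : Submonoid (unitaryGroupOfForm σ ((StdForm.antidiagonal N).over K)))
    (unitaryInt σ ((StdForm.antidiagonal N).over K)) (unitaryInt σ ((StdForm.antidiagonal N).over K))]

/-- **`𝒮_1(T_c) = S_c + ∑_{λ ≠ c} n_c(λ) S_λ` IN `ℋ(U(σ,J₀), K₀; R)`, EVERY COMMUTATIVE RING `R`**: the counting transform of the Cartan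
operator of an antidominant antisymmetric `c`, expanded in the orbit-sum basis of g49-#8, has coefficient `1` at `S_c`; the other
indices are the antidominant `λ ≠ c` in the support of `𝒮_1(T_c)`, with coefficients the coset counts `n_c(λ)`.
[cite: HenniartVigneras2013, §7.14] [cite: GrossSatake1998, (3.9)–(3.11)] [cite: BruhatTits1972, Prop. (4.4.4) (ii)] -/
theorem satakeTransform_one_doubleCosetOperator_eq_twistedOrbitSum_add (hd : UnramifiedLocalConjDatum σ ϖ) (hσ : ∃ x : K, σ x ≠ x)
    {c : Fin N → ℤ} (hc : Monotone c ∧ ∀ i, c (Fin.rev i) = -c i) :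
    (hd.isIwasawaExponent (N := N)).satakeTransform (1 : Multiplicative (Fin N → ℤ) →* R)
        (heckeAlgebra.doubleCosetOperator (unitaryInt σ ((StdForm.antidiagonal N).over K))
          (⟨zpowDiagGL (uniformizer_ne_zero hd.vϖ) c, zpowDiagGL_mem_unitaryGroupOfForm hd.σϖ _ hc.2⟩ :
            unitaryGroupOfForm σ ((StdForm.antidiagonal N).over K))) =
      twistedOrbitSum R N (Nat.sqrt (Nat.card 𝓀[K])) c +
        ∑ la ∈ (((hd.isIwasawaExponent (N := N)).satakeTransform (1 : Multiplicative (Fin N → ℤ) →* R)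
            (heckeAlgebra.doubleCosetOperator (unitaryInt σ ((StdForm.antidiagonal N).over K))
              (⟨zpowDiagGL (uniformizer_ne_zero hd.vϖ) c, zpowDiagGL_mem_unitaryGroupOfForm hd.σϖ _ hc.2⟩ :
                unitaryGroupOfForm σ ((StdForm.antidiagonal N).over K)))).coeff.support.filter Monotone).erase c,
          ((hd.isIwasawaExponent (N := N)).satakeTransform (1 : Multiplicative (Fin N → ℤ) →* R)
            (heckeAlgebra.doubleCosetOperator (unitaryInt σ ((StdForm.antidiagonal N).over K))
              (⟨zpowDiagGL (uniformizer_ne_zero hd.vϖ) c, zpowDiagGL_mem_unitaryGroupOfForm hd.σϖ _ hc.2⟩ :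
                unitaryGroupOfForm σ ((StdForm.antidiagonal N).over K)))).coeff la •
            twistedOrbitSum R N (Nat.sqrt (Nat.card 𝓀[K])) la := by
  classical
  set F := (hd.isIwasawaExponent (N := N)).satakeTransform (1 : Multiplicative (Fin N → ℤ) →* R)
    (heckeAlgebra.doubleCosetOperator (unitaryInt σ ((StdForm.antidiagonal N).over K))
      (⟨zpowDiagGL (uniformizer_ne_zero hd.vϖ) c, zpowDiagGL_mem_unitaryGroupOfForm hd.σϖ _ hc.2⟩ :
        unitaryGroupOfForm σ ((StdForm.antidiagonal N).over K))) with hF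
  have hF1 : F.coeff c = 1 := by
    rw [hF, hd.coeff_satakeTransform_doubleCosetOperator_zpowDiagGL_monotone_unitary 1 hc rfl, MonoidHom.one_apply]
  have hexp := eq_sum_coeff_smul_twistedOrbitSum_of_mem (hd.satakeTransform_one_mem_twistedSatakeTarget hσ
    (heckeAlgebra.doubleCosetOperator (k := R) (unitaryInt σ ((StdForm.antidiagonal N).over K))
      (⟨zpowDiagGL (uniformizer_ne_zero hd.vϖ) c, zpowDiagGL_mem_unitaryGroupOfForm hd.σϖ _ hc.2⟩ :
        unitaryGroupOfForm σ ((StdForm.antidiagonal N).over K))))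
  rw [← hF] at hexp
  by_cases hcs : c ∈ F.coeff.support.filter Monotone
  · conv_lhs => rw [hexp]
    rw [← Finset.add_sum_erase _ _ hcs, hF1, one_smul]
  · -- degenerate case `1 = 0` in `R`
    have h10 : (1 : R) = 0 := by
      by_contra h
      exact hcs (Finset.mem_filter.2 ⟨Finsupp.mem_support_iff.2 (by rw [hF1]; exact h), hc.1⟩)
    have h0 : twistedOrbitSum R N (Nat.sqrt (Nat.card 𝓀[K])) c = 0 := by
      rw [← one_smul R (twistedOrbitSum R N (Nat.sqrt (Nat.card 𝓀[K])) c), h10, zero_smul]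
    rw [h0, zero_add, Finset.erase_eq_of_notMem hcs]
    exact hexp

omit [Finite 𝓀[K]] in
/-- The indices of the expansion: antidominant `λ ≠ c` lying dominance-ABOVE `c` (`∑_{i<r} c_i ≤ ∑_{i<r} λ_i` for all `r`).
[cite: HenniartVigneras2013, §6.10, §7.14] [cite: BruhatTits1972, Prop. (4.4.4) (i)] -/
theorem ne_and_headSum_le_of_mem_erase_support (hd : UnramifiedLocalConjDatum σ ϖ) {c : Fin N → ℤ}
    (hc : Monotone c ∧ ∀ i, c (Fin.rev i) = -c i) {la : Fin N → ℤ}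
    (hla : la ∈ (((hd.isIwasawaExponent (N := N)).satakeTransform (1 : Multiplicative (Fin N → ℤ) →* R)
        (heckeAlgebra.doubleCosetOperator (unitaryInt σ ((StdForm.antidiagonal N).over K))
          (⟨zpowDiagGL (uniformizer_ne_zero hd.vϖ) c, zpowDiagGL_mem_unitaryGroupOfForm hd.σϖ _ hc.2⟩ :
            unitaryGroupOfForm σ ((StdForm.antidiagonal N).over K)))).coeff.support.filter Monotone).erase c) :
    la ≠ c ∧ Monotone la ∧ ∀ r, headSum c r ≤ headSum la r := by
  obtain ⟨hne, hla'⟩ := Finset.mem_erase.1 hla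
  obtain ⟨hsupp, hmono⟩ := Finset.mem_filter.1 hla'
  exact ⟨hne, hmono, fun r => hd.headSum_le_of_coeff_satakeTransform_doubleCosetOperator_monotone_ne_zero 1 hc
    (Finsupp.mem_support_iff.1 hsupp) r⟩

/-- **`𝒮_1(T_c) = x^c + ∑_{λ ≠ c} n_c(λ) x^λ` when `q_F = 0` in `R`** (the orbit sums are monomials, g49-#8
`twistedOrbitSum_of_cast_eq_zero`). [cite: HenniartVigneras2013, §7.14, §7.15 Remark 1] [cite: BruhatTits1972, Prop. (4.4.4)] -/
theorem satakeTransform_one_doubleCosetOperator_eq_single_add_of_cast_eq_zero (hd : UnramifiedLocalConjDatum σ ϖ)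
    (hσ : ∃ x : K, σ x ≠ x) (hq : ((Nat.sqrt (Nat.card 𝓀[K]) : ℕ) : R) = 0)
    {c : Fin N → ℤ} (hc : Monotone c ∧ ∀ i, c (Fin.rev i) = -c i) :
    (hd.isIwasawaExponent (N := N)).satakeTransform (1 : Multiplicative (Fin N → ℤ) →* R)
        (heckeAlgebra.doubleCosetOperator (unitaryInt σ ((StdForm.antidiagonal N).over K))
          (⟨zpowDiagGL (uniformizer_ne_zero hd.vϖ) c, zpowDiagGL_mem_unitaryGroupOfForm hd.σϖ _ hc.2⟩ :
            unitaryGroupOfForm σ ((StdForm.antidiagonal N).over K))) =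
      AddMonoidAlgebra.single c (1 : R) +
        ∑ la ∈ (((hd.isIwasawaExponent (N := N)).satakeTransform (1 : Multiplicative (Fin N → ℤ) →* R)
            (heckeAlgebra.doubleCosetOperator (unitaryInt σ ((StdForm.antidiagonal N).over K))
              (⟨zpowDiagGL (uniformizer_ne_zero hd.vϖ) c, zpowDiagGL_mem_unitaryGroupOfForm hd.σϖ _ hc.2⟩ :
                unitaryGroupOfForm σ ((StdForm.antidiagonal N).over K)))).coeff.support.filter Monotone).erase c,
          ((hd.isIwasawaExponent (N := N)).satakeTransform (1 : Multiplicative (Fin N → ℤ) →* R)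
            (heckeAlgebra.doubleCosetOperator (unitaryInt σ ((StdForm.antidiagonal N).over K))
              (⟨zpowDiagGL (uniformizer_ne_zero hd.vϖ) c, zpowDiagGL_mem_unitaryGroupOfForm hd.σϖ _ hc.2⟩ :
                unitaryGroupOfForm σ ((StdForm.antidiagonal N).over K)))).coeff la •
            AddMonoidAlgebra.single la (1 : R) := by
  conv_lhs => rw [hd.satakeTransform_one_doubleCosetOperator_eq_twistedOrbitSum_add hσ hc]
  rw [twistedOrbitSum_of_cast_eq_zero hq hc.1]
  congr 1
  refine Finset.sum_congr rfl fun la hla => ?_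
  rw [twistedOrbitSum_of_cast_eq_zero hq (hd.ne_and_headSum_le_of_mem_erase_support hc hla).2.1]

end Unitary

/-! ## §2 `O_N(J₀)` -/

section Orthogonal

variable [Finite 𝓀[K]]
  [IsHeckeTriple (⊤ : Submonoid (unitaryGroupOfForm (RingHom.id K) ((StdForm.antidiagonal N).over K)))
    (unitaryInt (RingHom.id K) ((StdForm.antidiagonal N).over K)) (unitaryInt (RingHom.id K) ((StdForm.antidiagonal N).over K))]

/-- **`𝒮_1(T_c) = S^{O}_c + ∑_{λ ≠ c} n_c(λ) S^{O}_λ` IN `ℋ(O_N(J₀), K₀; R)`, EVERY COMMUTATIVE RING `R`** (orbit-sum basis of g49-#10).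
[cite: HenniartVigneras2013, §7.14] [cite: GrossSatake1998, (3.9)–(3.11)] [cite: BruhatTits1972, Prop. (4.4.4) (ii)] -/
theorem satakeTransform_one_doubleCosetOperator_eq_orthogonalTwistedOrbitSum_add (hd : UnramifiedLocalConjDatum (RingHom.id K) ϖ)
    {c : Fin N → ℤ} (hc : Monotone c ∧ ∀ i, c (Fin.rev i) = -c i) :
    (hd.isIwasawaExponent (N := N)).satakeTransform (1 : Multiplicative (Fin N → ℤ) →* R)
        (heckeAlgebra.doubleCosetOperator (unitaryInt (RingHom.id K) ((StdForm.antidiagonal N).over K))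
          (⟨zpowDiagGL (uniformizer_ne_zero hd.vϖ) c, zpowDiagGL_mem_unitaryGroupOfForm hd.σϖ _ hc.2⟩ :
            unitaryGroupOfForm (RingHom.id K) ((StdForm.antidiagonal N).over K))) =
      orthogonalTwistedOrbitSum R N (Nat.card 𝓀[K]) c +
        ∑ la ∈ (((hd.isIwasawaExponent (N := N)).satakeTransform (1 : Multiplicative (Fin N → ℤ) →* R)
            (heckeAlgebra.doubleCosetOperator (unitaryInt (RingHom.id K) ((StdForm.antidiagonal N).over K))
              (⟨zpowDiagGL (uniformizer_ne_zero hd.vϖ) c, zpowDiagGL_mem_unitaryGroupOfForm hd.σϖ _ hc.2⟩ :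
                unitaryGroupOfForm (RingHom.id K) ((StdForm.antidiagonal N).over K)))).coeff.support.filter Monotone).erase c,
          ((hd.isIwasawaExponent (N := N)).satakeTransform (1 : Multiplicative (Fin N → ℤ) →* R)
            (heckeAlgebra.doubleCosetOperator (unitaryInt (RingHom.id K) ((StdForm.antidiagonal N).over K))
              (⟨zpowDiagGL (uniformizer_ne_zero hd.vϖ) c, zpowDiagGL_mem_unitaryGroupOfForm hd.σϖ _ hc.2⟩ :
                unitaryGroupOfForm (RingHom.id K) ((StdForm.antidiagonal N).over K)))).coeff la •
            orthogonalTwistedOrbitSum R N (Nat.card 𝓀[K]) la := by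
  classical
  set F := (hd.isIwasawaExponent (N := N)).satakeTransform (1 : Multiplicative (Fin N → ℤ) →* R)
    (heckeAlgebra.doubleCosetOperator (unitaryInt (RingHom.id K) ((StdForm.antidiagonal N).over K))
      (⟨zpowDiagGL (uniformizer_ne_zero hd.vϖ) c, zpowDiagGL_mem_unitaryGroupOfForm hd.σϖ _ hc.2⟩ :
        unitaryGroupOfForm (RingHom.id K) ((StdForm.antidiagonal N).over K))) with hF
  have hF1 : F.coeff c = 1 := by
    rw [hF, hd.coeff_satakeTransform_doubleCosetOperator_zpowDiagGL_monotone_unitary 1 hc rfl, MonoidHom.one_apply]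
  have hexp := eq_sum_coeff_smul_orthogonalTwistedOrbitSum_of_mem (hd.satakeTransform_one_mem_orthogonalTwistedSatakeTarget
    (heckeAlgebra.doubleCosetOperator (k := R) (unitaryInt (RingHom.id K) ((StdForm.antidiagonal N).over K))
      (⟨zpowDiagGL (uniformizer_ne_zero hd.vϖ) c, zpowDiagGL_mem_unitaryGroupOfForm hd.σϖ _ hc.2⟩ :
        unitaryGroupOfForm (RingHom.id K) ((StdForm.antidiagonal N).over K))))
  rw [← hF] at hexp
  by_cases hcs : c ∈ F.coeff.support.filter Monotone
  · conv_lhs => rw [hexp]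
    rw [← Finset.add_sum_erase _ _ hcs, hF1, one_smul]
  · have h10 : (1 : R) = 0 := by
      by_contra h
      exact hcs (Finset.mem_filter.2 ⟨Finsupp.mem_support_iff.2 (by rw [hF1]; exact h), hc.1⟩)
    have h0 : orthogonalTwistedOrbitSum R N (Nat.card 𝓀[K]) c = 0 := by
      rw [← one_smul R (orthogonalTwistedOrbitSum R N (Nat.card 𝓀[K]) c), h10, zero_smul]
    rw [h0, zero_add, Finset.erase_eq_of_notMem hcs]
    exact hexp

omit [Finite 𝓀[K]] in
/-- The indices of the orthogonal expansion: antidominant `λ ≠ c` dominance-above `c`. [cite: HenniartVigneras2013, §6.10, §7.14]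
[cite: BruhatTits1972, Prop. (4.4.4) (i)] -/
theorem ne_and_headSum_le_of_mem_erase_support_orthogonal (hd : UnramifiedLocalConjDatum (RingHom.id K) ϖ) {c : Fin N → ℤ}
    (hc : Monotone c ∧ ∀ i, c (Fin.rev i) = -c i) {la : Fin N → ℤ}
    (hla : la ∈ (((hd.isIwasawaExponent (N := N)).satakeTransform (1 : Multiplicative (Fin N → ℤ) →* R)
        (heckeAlgebra.doubleCosetOperator (unitaryInt (RingHom.id K) ((StdForm.antidiagonal N).over K))
          (⟨zpowDiagGL (uniformizer_ne_zero hd.vϖ) c, zpowDiagGL_mem_unitaryGroupOfForm hd.σϖ _ hc.2⟩ :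
            unitaryGroupOfForm (RingHom.id K) ((StdForm.antidiagonal N).over K)))).coeff.support.filter Monotone).erase c) :
    la ≠ c ∧ Monotone la ∧ ∀ r, headSum c r ≤ headSum la r := by
  obtain ⟨hne, hla'⟩ := Finset.mem_erase.1 hla
  obtain ⟨hsupp, hmono⟩ := Finset.mem_filter.1 hla'
  exact ⟨hne, hmono, fun r => hd.headSum_le_of_coeff_satakeTransform_doubleCosetOperator_monotone_ne_zero 1 hc
    (Finsupp.mem_support_iff.1 hsupp) r⟩

end Orthogonal

end UnramifiedLocalConjDatum

end Literature.NumberTheory.Automorphic.HermitianLattice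

end
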